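import Summits.CriticalPhenomena.PercolationContinuityZ3.Theorems.PercNearOneGluingNoHeavyConstsMDLXJoint
import Literature.Probability.Percolation.TwoSetConditionalAssociation
import Literature.Probability.Percolation.KozmaNitzanSeparatingTriple
import Literature.Probability.Percolation.TripodExchange
import HarnessLib

/-!
# Source-enlargement marker dominance with no avoided set: the `X = ∅` case of the cylinder form R(S) of MDL(X)′
# (PAPER-2 track (ii): constants of the CSH family; seat `prim-consts-2`, gen 10)

builds on p205010 (kernel theorem, internal audit signed; external expert review pending).  Support file
(`--supports stmt-CriticalPhenomena-4575`); rows A6/A11 of `run/shared/lean/prim/consts/CONSTANTS.md`; memo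
`run/shared/lean/prim/consts/FROM-prim-consts-2-g10-VERTEX-INDUCTION.md` §3.  No definitions, no sorries; standard axioms.

CONTEXT.  At a CYLINDER functional `F = 1{ω ⊇ C}` (`C ∋ s` connected, vertex set `S`) the conjecture `Consts.MDLXJoint` (MDL(X)′) is exactly the
two-source kernel inequality R(S): `g_S(z) ≥ p'·g_S(y)`, `g_S(t) = K(S,X)K(s,X∪t) − K(s,X)K(S,X∪t)`, i.e.
`P(z ∈ C_S | S ↮ X) − P(z ∈ C_s | s ↮ X) ≥ p'·[P(y ∈ C_S | S ↮ X) − P(y ∈ C_s | s ↮ X)]` ("enlarging the source from the point `s` to the set `S` gains at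
least `p'` times as much towards `z` as towards `y`"); cylinders are where the sharp constant of MDL(X)′ is attained in 797 of 798 exact instances (memo §0(3)).
For `X = ∅` the gain towards `t` is `μ(s ↮ t, t ↔ S')`, `S' = S ∖ {s}`, and R(S) is the theorem of this file:

* `Consts.sourceEnlarge_marker_noAvoid` — **THEOREM.** For every finite weighted graph, vertices `s, y, z` and every set `S'` of vertices,
  `μ(y ↮ s) · μ(s ↮ z, z ↔ S') ≥ μ(y ↮ s, y ↔ S') · μ(y ↮ s, y ↔ z)`,
  i.e. `μ(s ↮ z, z ↔ S') ≥ P(y ↔ z | y ↮ s) · μ(s ↮ y, y ↔ S')` (`t ↔ S'` = `t` is joined to some vertex of `S'`).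
  Proof: `{y ↮ s, y ↔ S', y ↔ z} ⊆ {s ↮ z, z ↔ S'}`, and given `y ↮ s` the increasing functions `1{y ↔ S'}`, `1{y ↔ z}` of the cluster of `y` are positively
  correlated (van den Berg–Häggström–Kahn, Thm 1.3 with sets: `BHK2006_setClusterConditionalPositiveAssociation` for the source `{y}` avoiding `{s}`).
The `X ≠ ∅` inequality R(S) is OPEN (numerically 0 negative / 1 050 exact instances of gen 10, 0 / 3 508 corner-seeking climbs of referee gen 64, 0 / 190 726 of
kit j159286, all `S ∋ s`).  CORRECTION (2026-08-22, referee prim-consts-3 gen 64 and this seat's gen 11, independently): of the split `K(s,X)·R1 + R2` of memo g10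
§3, **R1 is FALSE** (exact n = 6 witness, referee g64; n = 7 kernel instance `Consts.ThreeSepCex.threeSep_R1_neg`) and so is the positive association of the clusters
under three-way separation that was to imply it (`Consts.not_threeSep_posCorrelation`, `T/…ConstsThreeSepNegative.lean`; referee g64 6-edge avoidance-event
witness; ttrl2/k3cells cell K3-A, 2026-08-19); **R2 (= MDLX-J2 at avoidance indicators) is a consequence of MDL(X)′ itself** (`Consts.mdlxJoint_J2`,
`T/…ConstsMDLXJointTwoOneClass.lean`) and, like R(S), unrefuted.  So R(S) must be attacked without this split; the reduction "MDL(X)′ at cylinders ⟸ R(S)" is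
`Consts.mdlxJoint_cylinder_of_sourceEnlarge`, and the `X ≠ ∅` analogue of this file's theorem WITHOUT the `u ↮ X` constraint is `Consts.sourceSwitch_marker`
(both `T/…ConstsMDLXJointCylinder.lean`).
[cite: VandenbergHaggstromKahn2005, Thm. 1.3 (p. 6) with Remark 1 after Thm. 1.2 (p. 5)]
-/

noncomputable section

namespace Summit.CriticalPhenomena.PercolationContinuityZ3.Theorems

open MeasureTheory Set Literature.Probability.LatticeModels Literature.Probability.Percolation
open scoped Classical

namespace Consts

variable {V : Type*} [Fintype V]

/-- **Source-enlargement marker dominance, no avoided set (the `X = ∅` case of R(S)).**  For all `s, y, z` and every vertex set `S'`: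
`μ(y ↮ s) · μ({s ↮ z} ∩ {z ↔ S'}) ≥ μ({y ↮ s} ∩ {y ↔ S'}) · μ({y ↮ s} ∩ {y ↔ z})`, where `{t ↔ S'} = {ω | ∃ u ∈ S', t ↔ u}`.
From vdBHK Thm 1.3 with sets (cluster of `y` given `y ↮ s`) and the inclusion `{y ↮ s, y ↔ S', y ↔ z} ⊆ {s ↮ z, z ↔ S'}`.
[cite: VandenbergHaggstromKahn2005, Thm. 1.3 (p. 6) with Remark 1 after Thm. 1.2 (p. 5)] -/
theorem sourceEnlarge_marker_noAvoid (w : Sym2 V → unitInterval) (s y z : V) (S' : Set V) :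
    (prodBernoulli w).real ({ω : BondConfig V | ¬ (openGraph ω).Reachable y s} ∩ {ω | ∃ u ∈ S', (openGraph ω).Reachable y u}) *
        (prodBernoulli w).real ({ω : BondConfig V | ¬ (openGraph ω).Reachable y s} ∩ openConn y z) ≤
      (prodBernoulli w).real {ω : BondConfig V | ¬ (openGraph ω).Reachable y s} *
        (prodBernoulli w).real ({ω : BondConfig V | ¬ (openGraph ω).Reachable s z} ∩ {ω | ∃ u ∈ S', (openGraph ω).Reachable z u}) := by
  classical
  set μ := prodBernoulli w with hμ
  set N : Set (BondConfig V) := {ω | ¬ (openGraph ω).Reachable y s} with hN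
  set E : Set (BondConfig V) := {ω | ∃ u ∈ S', (openGraph ω).Reachable y u} with hE
  set W : Set (BondConfig V) := openConn y z with hW
  set L : Set (BondConfig V) := {ω : BondConfig V | ¬ (openGraph ω).Reachable s z} ∩ {ω | ∃ u ∈ S', (openGraph ω).Reachable z u}
    with hL
  -- the BHK conditioning event `{ {y} ↮ {s} }` is `N`
  have hN' : {ω : BondConfig V | ∀ a ∈ ({y} : Set V), ∀ b ∈ ({s} : Set V), ¬ (openGraph ω).Reachable a b} = N := by
    ext ω
    simp only [hN, mem_setOf_eq, mem_singleton_iff, forall_eq]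
  -- the two increasing functionals of the cluster of `y`
  set F : Set (Sym2 V) → ℝ := fun C => if (∃ u ∈ S', (openGraph C).Reachable y u) then (1 : ℝ) else 0 with hF
  set G : Set (Sym2 V) → ℝ := connIndicatorFn y z with hG
  have hFm : Monotone F := by
    refine TripodExchange.predIndicator_monotone ?_
    rintro C C' hCC' ⟨u, hu, hr⟩
    exact ⟨u, hu, hr.mono (openGraph_mono hCC')⟩
  have hGm : Monotone G := monotone_connIndicatorFn y z
  have hU : ∀ ω : BondConfig V, (⋃ a ∈ ({y} : Set V), openEdgeCluster ω a) = openEdgeCluster ω y := by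
    intro ω; ext e; simp
  have hFω : ∀ ω : BondConfig V, F (⋃ a ∈ ({y} : Set V), openEdgeCluster ω a) = E.indicator 1 ω := by
    intro ω
    have hiff : (∃ u ∈ S', (openGraph (⋃ a ∈ ({y} : Set V), openEdgeCluster ω a)).Reachable y u) ↔
        ∃ u ∈ S', (openGraph ω).Reachable y u := by
      constructor
      · rintro ⟨u, hu, hr⟩
        exact ⟨u, hu, (KNSep.reachable_iff_cluster ω ({y} : Set V) (mem_singleton y) u).2 hr⟩
      · rintro ⟨u, hu, hr⟩
        exact ⟨u, hu, (KNSep.reachable_iff_cluster ω ({y} : Set V) (mem_singleton y) u).1 hr⟩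
    simp only [hF, hiff]
    exact TwoSetConditionalAssociation.predIndicator_eq_indicator (fun ω' => ∃ u ∈ S', (openGraph ω').Reachable y u) ω
  have hGω : ∀ ω : BondConfig V, G (⋃ a ∈ ({y} : Set V), openEdgeCluster ω a) = W.indicator 1 ω := by
    intro ω
    rw [hU ω, hG, connIndicatorFn_openEdgeCluster]
  -- vdBHK Thm 1.3 with sets: `(∫_N F)(∫_N G) ≤ μ(N) ∫_N F G`
  have key := BHK2006_setClusterConditionalPositiveAssociation w ({y} : Set V) ({s} : Set V) F G hFm hGm
  simp only [hN', hFω, hGω, TripodExchange.setIntegral_indicator_one_eq,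
    TripodExchange.setIntegral_indicator_mul_indicator_eq] at key
  -- key : μ.real (N ∩ E) * μ.real (N ∩ W) ≤ μ.real N * μ.real (N ∩ (E ∩ W))
  -- the inclusion `N ∩ (E ∩ W) ⊆ L`
  have hsub : N ∩ (E ∩ W) ⊆ L := by
    rintro ω ⟨hys, ⟨u, hu, hyu⟩, hyz⟩
    have hyz' : (openGraph ω).Reachable y z := hyz
    refine ⟨fun hsz => hys (hyz'.trans hsz.symm), u, hu, hyz'.symm.trans hyu⟩
  have hmono : μ.real (N ∩ (E ∩ W)) ≤ μ.real L := measureReal_mono hsub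
  have hNnn : 0 ≤ μ.real N := measureReal_nonneg
  calc μ.real (N ∩ E) * μ.real (N ∩ W) ≤ μ.real N * μ.real (N ∩ (E ∩ W)) := key
    _ ≤ μ.real N * μ.real L := mul_le_mul_of_nonneg_left hmono hNnn

end Consts

end Summit.CriticalPhenomena.PercolationContinuityZ3.Theorems

end
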